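import Literature.Geometry.Symplectic.PfaffianFour
import Literature.Geometry.Kaehler.ManifoldFormsChart
import Literature.Geometry.Kaehler.ManifoldFormsPullback
import Literature.Topology.FourManifolds.SmoothOrientation
import Literature.Topology.FourManifolds.IntersectionLatticeOrientationProofs
import HarnessLib

/-!
# The symplectic orientation of a symplectic `4`-manifold and of a symplectic surface

Topic `Literature/Geometry/Symplectic`. Support for the named fact
`Literature.Geometry.Symplectic.canonicalClass_sq_and_adjunction_of_symplectic_four`
(`CanonicalClassSqAndAdjunctionOfSymplecticFour.lean`; McDuff–Salamon 2017, Rem. 4.1.10 and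
Ex. 4.4.5), which asks, for a closed symplectic `4`-manifold `(N, s)`, for "the symplectic"
homological `ℤ`-orientation `μ` of `N` and, for every symplectic surface `b : S ↪ N`, for "the
symplectic" orientation `μS` of `S`. This file constructs both objects, following the printed
argument (McDuff–Salamon 2017, §2.1, Cor. 2.1.4 and the paragraph after it / Def. 4.1.4: a
nondegenerate `2`-form `ω` on a `2n`-manifold has `ωⁿ ≠ 0` everywhere, a volume form, hence an
orientation), in the tree's vocabulary (`Literature.Topology.FourManifolds.SmoothOrientation`,
then `HomologicalOrientation ℤ` through the tree's bridge
`HomologicalOrientationOfSmooth.homologicalOrientationOfSmooth`, Bredon 1993 VI.7 /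
Milnor–Stasheff 1974 App. A):

* §1 (any dimension `n`, any degree `k`): `smoothOrientationOfCoeff` — if `c` is a continuous
  functional on `k`-forms on `ℝⁿ` transforming under pull-back by the determinant
  (`c (α ∘ A) = det A · c α`, a "top coefficient"), and `s` is a smooth `k`-form on an
  `n`-manifold with `c (s_y) ≠ 0` everywhere, then `y ↦ sign c(s_y) · [e₀, …, e_{n-1}]` is a
  smooth orientation. Local constancy is read off the chart representative
  (`Literature.Geometry.Kaehler.MForm.inChart_eq_of_mem_target`:
  `s.inChart x (e y) = s_y ∘ τ_{x → y}`), continuous at the centre of the chart.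
* §2 (`n = 4`, `c = Pf`, the chart Pfaffian of `OrigamiForm.lean` / `PfaffianFour.lean`,
  `½ s ∧ s = Pf(s) e⁰¹²³`, non-zero for nondegenerate `s` by `pfaffian_eq_zero_iff`):
  `symplecticSmoothOrientation s`, `symplecticOrientation s : HomologicalOrientation ℤ N 4`.
* §3 (`n = 2`, `c α = α(e₀, e₁)`): `surfaceSmoothOrientation`, `surfaceOrientation`, and for a
  smooth map `b : S → N` into a `4`-manifold with `b^* s` nondegenerate (a symplectic surface)
  `symplecticSurfaceOrientation s b : HomologicalOrientation ℤ S 2` (the `μS` of the fact), via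
  the tree's proved pull-back calculus (`Literature.Geometry.Kaehler.MForm.pullback`,
  `isSmoothForm_pullback`).

Only smoothness and pointwise nondegeneracy are used (closedness of `s` plays no role for the
orientation). Everything is proved; no named facts.

## References

* D. McDuff, D. Salamon, *Introduction to Symplectic Topology*, 3rd ed., OUP (2017), §2.1
  Cor. 2.1.4 (nondegenerate iff `ωⁿ ≠ 0`; the symplectic orientation), Def. 4.1.4,
  Rem. 4.1.10, Ex. 4.4.5. [McDuffSalamon2017]
* J. Milnor, J. Stasheff, *Characteristic Classes* (1974), Appendix A (orientations and the
  preferred generators `μ_x`). [MilnorStasheff1974]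
-/

noncomputable section

open scoped Manifold ContDiff Topology
open Set Function Filter Module
open Literature.Geometry.Kaehler Literature.Topology.FourManifolds
  Literature.AlgebraicTopology.SingularHomology

namespace Literature.Geometry.Symplectic

/-- Local notation: `𝔼 n` is the model space `EuclideanSpace ℝ (Fin n)`. -/
local notation "𝔼" n:arg => EuclideanSpace ℝ (Fin n)

universe u v

/-! ### §1. Orientation from a non-vanishing top coefficient -/

section Coeff

variable {n : ℕ}

/-- Two real numbers of fixed non-zero signs: `a` and `d · a` have the same sign iff `d > 0`.
[folklore] -/
private theorem pos_iff_pos_mul_iff {d a : ℝ} (hd : d ≠ 0) (ha : a ≠ 0) :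
    ((0 < a ↔ 0 < d * a) ↔ 0 < d) := by
  rcases lt_or_gt_of_ne hd with hd | hd <;> rcases lt_or_gt_of_ne ha with ha | ha
  · have : 0 < d * a := mul_pos_of_neg_of_neg hd ha
    constructor
    · intro h
      exact absurd (h.2 this) (not_lt.2 ha.le)
    · intro h
      exact absurd h (not_lt.2 hd.le)
  · have : d * a < 0 := mul_neg_of_neg_of_pos hd ha
    constructor
    · intro h
      exact absurd (h.1 ha) (not_lt.2 this.le)
    · intro h
      exact absurd h (not_lt.2 hd.le)
  · have : d * a < 0 := mul_neg_of_pos_of_neg hd ha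
    exact iff_of_true (iff_of_false (not_lt.2 ha.le) (not_lt.2 this.le)) hd
  · exact iff_of_true (iff_of_true ha (mul_pos hd ha)) hd

variable (n) in
/-- The orientation `± [e₀, …, e_{n-1}]` of `ℝⁿ` according to the sign of a real number
(positive: the standard orientation `euclideanOrientation n`; otherwise its opposite). [folklore] -/
def signOrientationIn (t : ℝ) : _root_.Orientation ℝ (𝔼 n) (Fin (finrank ℝ (𝔼 n))) :=
  if 0 < t then euclideanOrientation n else -euclideanOrientation n

/-- Two sign orientations agree iff the signs agree. [folklore] -/
theorem signOrientationIn_eq_iff {a b : ℝ} :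
    signOrientationIn n a = signOrientationIn n b ↔ (0 < a ↔ 0 < b) := by
  have hne : euclideanOrientation n ≠ -euclideanOrientation n := Module.Ray.ne_neg_self _
  unfold signOrientationIn
  by_cases ha : 0 < a <;> by_cases hb : 0 < b <;> simp [ha, hb, hne, hne.symm]

variable {N : Type u} [TopologicalSpace N] [ChartedSpace (𝔼 n) N] {k : ℕ}
  (c : ((𝔼 n) [⋀^Fin k]→L[ℝ] ℝ) → ℝ)

/-- **Change of frame for a top coefficient**: if `c` transforms under pull-back by the
determinant, then for `y` in the source of the chart at `x` the coefficient of the representative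
of `s` in the chart at `x`, at the image of `y`, is `det(τ_{x→y}) · c(s_y)`
(`Literature.Geometry.Kaehler.MForm.inChart_eq_of_mem_target`). [folklore] -/
theorem coeff_inChart_extChartAt [IsManifold (𝓡 n) ∞ N]
    (hcomp : ∀ (α : (𝔼 n) [⋀^Fin k]→L[ℝ] ℝ) (A : (𝔼 n) →L[ℝ] 𝔼 n),
      c (α.compContinuousLinearMap A) = LinearMap.det (A : (𝔼 n) →ₗ[ℝ] 𝔼 n) * c α)
    (s : MForm (𝓡 n) N ℝ k) {x y : N} (hy : y ∈ (extChartAt (𝓡 n) x).source) :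
    c (s.inChart x (extChartAt (𝓡 n) x y)) =
      LinearMap.det ((tangentCoordChange (𝓡 n) x y y : (𝔼 n) →L[ℝ] 𝔼 n) : (𝔼 n) →ₗ[ℝ] 𝔼 n) *
        c (s y) := by
  have hy' : extChartAt (𝓡 n) x y ∈ (extChartAt (𝓡 n) x).target := (extChartAt (𝓡 n) x).map_source hy
  rw [s.inChart_eq_of_mem_target hy', (extChartAt (𝓡 n) x).left_inv hy]
  exact hcomp (s y) _

/-- For a continuous coefficient `c` and a smooth form `s`, `w ↦ c (s.inChart x w)` is continuous
at the centre of the chart at `x`. [folklore] -/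
theorem continuousAt_coeff_inChart (hcont : Continuous c) (s : MForm (𝓡 n) N ℝ k)
    (hs : IsSmoothForm s) (x : N) :
    ContinuousAt (fun w : 𝔼 n ↦ c (s.inChart x w)) (extChartAt (𝓡 n) x x) := by
  have h : ContDiffWithinAt ℝ ∞ (s.inChart x) (range (𝓡 n)) (extChartAt (𝓡 n) x x) := hs x
  rw [ModelWithCorners.range_eq_univ, contDiffWithinAt_univ] at h
  exact hcont.continuousAt.comp h.continuousAt

/-- Near `x`, the coefficient of the representative of `s` in the chart at `x` has the sign of
`c(s_x)`, provided `c(s_x) ≠ 0`. [folklore] -/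
theorem eventually_coeff_inChart_pos_iff [IsManifold (𝓡 n) ∞ N] (hcont : Continuous c)
    (s : MForm (𝓡 n) N ℝ k)
    (hs : IsSmoothForm s) {x : N} (hx : c (s x) ≠ 0) :
    ∀ᶠ y in 𝓝 x, (0 < c (s.inChart x (extChartAt (𝓡 n) x y)) ↔ 0 < c (s x)) := by
  have hc := continuousAt_coeff_inChart c hcont s hs x
  have hx0 : c (s.inChart x (extChartAt (𝓡 n) x x)) = c (s x) := by
    rw [s.inChart_apply_self]
  have hev : ∀ᶠ w in 𝓝 (extChartAt (𝓡 n) x x), (0 < c (s.inChart x w) ↔ 0 < c (s x)) := by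
    rcases lt_or_gt_of_ne hx with hneg | hpos
    · have hneg' : c (s.inChart x (extChartAt (𝓡 n) x x)) < 0 := by rwa [hx0]
      have h1 : ∀ᶠ w in 𝓝 (extChartAt (𝓡 n) x x), c (s.inChart x w) < 0 :=
        hc.eventually_lt_const hneg'
      filter_upwards [h1] with w hw
      exact iff_of_false (not_lt.2 hw.le) (not_lt.2 hneg.le)
    · have hpos' : 0 < c (s.inChart x (extChartAt (𝓡 n) x x)) := by rwa [hx0]
      have h1 : ∀ᶠ w in 𝓝 (extChartAt (𝓡 n) x x), 0 < c (s.inChart x w) :=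
        hc.eventually_const_lt hpos'
      filter_upwards [h1] with w hw
      exact iff_of_true hw hpos
  exact (continuousAt_extChartAt (I := 𝓡 n) x).eventually hev

/-- **A smooth form with a nowhere-vanishing top coefficient orients the manifold**
(McDuff–Salamon 2017, §2.1: a volume form determines an orientation): for a continuous
coefficient `c` on `k`-forms on `ℝⁿ` transforming by the determinant and a smooth `k`-form `s`
with `c(s_y) ≠ 0` for all `y`, the family `y ↦ sign c(s_y) · [e₀, …, e_{n-1}]` is a smooth
orientation: near `x`, `c(s.inChart x (e y)) = det(τ_{x→y}) · c(s_y)` has the sign of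
`c(s_x)`, so the signs at `y` and `x` agree iff `det τ > 0`. [cite: McDuffSalamon2017, §2.1 Cor. 2.1.4] -/
def smoothOrientationOfCoeff [IsManifold (𝓡 n) ∞ N] (hcont : Continuous c)
    (hcomp : ∀ (α : (𝔼 n) [⋀^Fin k]→L[ℝ] ℝ) (A : (𝔼 n) →L[ℝ] 𝔼 n),
      c (α.compContinuousLinearMap A) = LinearMap.det (A : (𝔼 n) →ₗ[ℝ] 𝔼 n) * c α)
    (s : MForm (𝓡 n) N ℝ k) (hs : IsSmoothForm s) (hne : ∀ y, c (s y) ≠ 0) :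
    SmoothOrientation (𝓡 n) N where
  toFun y := signOrientationIn n (c (s y))
  eventually_eq_iff' x := by
    filter_upwards [eventually_coeff_inChart_pos_iff c hcont s hs (hne x),
      extChartAt_source_mem_nhds (I := 𝓡 n) x] with y hy hys
    rw [signOrientationIn_eq_iff, coeff_inChart_extChartAt c hcomp s hys] at *
    have hys' : y ∈ (chartAt (𝔼 n) x).source := by rwa [extChartAt_source] at hys
    have hdet := HomologicalOrientationOfSmooth.det_tangentCoordChange_mul (n := n) hys'
    simp only [ContinuousLinearMap.det] at hdet
    have hd₂ : LinearMap.det ((tangentCoordChange (𝓡 n) x y y : (𝔼 n) →L[ℝ] 𝔼 n) :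
        (𝔼 n) →ₗ[ℝ] 𝔼 n) ≠ 0 := right_ne_zero_of_mul_eq_one hdet
    rw [← hy, pos_iff_pos_mul_iff hd₂ (hne y)]
    constructor
    · intro h
      by_contra h'
      nlinarith [hdet, h, not_lt.1 h']
    · intro h
      by_contra h'
      nlinarith [hdet, h, not_lt.1 h']

/-- The orientation `smoothOrientationOfCoeff` at a point: `sign c(s_y) · [e₀, …, e_{n-1}]`.
[folklore] -/
theorem smoothOrientationOfCoeff_apply [IsManifold (𝓡 n) ∞ N] (hcont : Continuous c)
    (hcomp : ∀ (α : (𝔼 n) [⋀^Fin k]→L[ℝ] ℝ) (A : (𝔼 n) →L[ℝ] 𝔼 n),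
      c (α.compContinuousLinearMap A) = LinearMap.det (A : (𝔼 n) →ₗ[ℝ] 𝔼 n) * c α)
    (s : MForm (𝓡 n) N ℝ k) (hs : IsSmoothForm s) (hne : ∀ y, c (s y) ≠ 0) (y : N) :
    smoothOrientationOfCoeff c hcont hcomp s hs hne y = signOrientationIn n (c (s y)) := rfl

end Coeff

/-! ### §2. Dimension four: the symplectic orientation -/

section Four

variable {N : Type u} [TopologicalSpace N] [ChartedSpace (𝔼 4) N] [IsManifold (𝓡 4) ∞ N]

/-- A nondegenerate `2`-form on `ℝ⁴` has non-zero Pfaffian (McDuff–Salamon 2017, Cor. 2.1.4: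
`ω ∧ ω ≠ 0`; the tree's `pfaffian_eq_zero_iff`). [cite: McDuffSalamon2017, §2.1 Cor. 2.1.4] -/
theorem pfaffian_ne_zero_of_nondegenerate (α : (𝔼 4) [⋀^Fin 2]→L[ℝ] ℝ)
    (hα : ∀ v : 𝔼 4, v ≠ 0 → ∃ w, α ![v, w] ≠ 0) : pfaffian α ≠ 0 := by
  intro h0
  obtain ⟨v, hv, hker⟩ := (pfaffian_eq_zero_iff α).1 h0
  obtain ⟨w, hw⟩ := hα v hv
  exact hw (hker w)

/-- **The symplectic orientation of a symplectic `4`-manifold is a smooth orientation**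
(McDuff–Salamon 2017, §2.1 Cor. 2.1.4 and Def. 4.1.4: `ω ∧ ω` is a volume form and orients
`M`): at `y` it is `sign Pf(s_y) · [e₀, e₁, e₂, e₃]`, the Pfaffian being taken in the preferred
chart at `y` (`smoothOrientationOfCoeff` with `c = Pf`, which is continuous and transforms by the
determinant, `pfaffian_compContinuousLinearMap`). Only smoothness and pointwise nondegeneracy of
`s` are used. [cite: McDuffSalamon2017, §2.1 Cor. 2.1.4 and Def. 4.1.4] -/
def symplecticSmoothOrientation (s : MForm (𝓡 4) N ℝ 2) (hs : IsSmoothForm s)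
    (hnd : ∀ x (v : TangentSpace (𝓡 4) x), v ≠ 0 → ∃ w : TangentSpace (𝓡 4) x, s x ![v, w] ≠ 0) :
    SmoothOrientation (𝓡 4) N :=
  smoothOrientationOfCoeff pfaffian continuous_pfaffian pfaffian_compContinuousLinearMap s hs
    fun y ↦ pfaffian_ne_zero_of_nondegenerate _ (hnd y)

/-- The symplectic smooth orientation at a point: `sign Pf(s_y) · [e₀, …, e₃]`. [folklore] -/
theorem symplecticSmoothOrientation_apply (s : MForm (𝓡 4) N ℝ 2) (hs : IsSmoothForm s)
    (hnd : ∀ x (v : TangentSpace (𝓡 4) x), v ≠ 0 → ∃ w : TangentSpace (𝓡 4) x, s x ![v, w] ≠ 0)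
    (y : N) :
    symplecticSmoothOrientation s hs hnd y = signOrientationIn 4 (pfaffian (s y)) := rfl

/-- A `4`-manifold carrying a smooth everywhere-nondegenerate `2`-form is orientable
(McDuff–Salamon 2017, §2.1). [cite: McDuffSalamon2017, §2.1] -/
theorem isOrientable_of_nondegenerate (s : MForm (𝓡 4) N ℝ 2) (hs : IsSmoothForm s)
    (hnd : ∀ x (v : TangentSpace (𝓡 4) x), v ≠ 0 → ∃ w : TangentSpace (𝓡 4) x, s x ![v, w] ≠ 0) :
    IsOrientable (𝓡 4) N :=
  ⟨symplecticSmoothOrientation s hs hnd⟩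

/-- **The symplectic orientation of a symplectic `4`-manifold as a homological `ℤ`-orientation**
(the `μ` of `canonicalClass_sq_and_adjunction_of_symplectic_four`): the homological orientation
attached to `symplecticSmoothOrientation s` by the tree's bridge
`HomologicalOrientationOfSmooth.homologicalOrientationOfSmooth` (Bredon 1993, VI.7, Prop. 7.14 and
Thm. 7.15; Milnor–Stasheff 1974, Appendix A: the preferred generator `μ_y ∈ H₄(N, N - y; ℤ)` of an
oriented manifold). [cite: MilnorStasheff1974, Appendix A] -/
def symplecticOrientation [T2Space N] (s : MForm (𝓡 4) N ℝ 2) (hs : IsSmoothForm s)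
    (hnd : ∀ x (v : TangentSpace (𝓡 4) x), v ≠ 0 → ∃ w : TangentSpace (𝓡 4) x, s x ![v, w] ≠ 0) :
    HomologicalOrientation ℤ N 4 :=
  HomologicalOrientationOfSmooth.homologicalOrientationOfSmooth (symplecticSmoothOrientation s hs hnd)

/-- A `4`-manifold carrying a smooth everywhere-nondegenerate `2`-form is `ℤ`-orientable in the
homological sense. [cite: MilnorStasheff1974, Appendix A] -/
theorem isOrientableOver_int_of_nondegenerate [T2Space N] (s : MForm (𝓡 4) N ℝ 2)
    (hs : IsSmoothForm s)
    (hnd : ∀ x (v : TangentSpace (𝓡 4) x), v ≠ 0 → ∃ w : TangentSpace (𝓡 4) x, s x ![v, w] ≠ 0) :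
    IsOrientableOver ℤ N 4 :=
  ⟨symplecticOrientation s hs hnd⟩

end Four

/-! ### §3. Dimension two: symplectic surfaces -/

section Two

/-- The top coefficient of a `2`-form on `ℝ²`: its value `α(e₀, e₁)` on the standard basis.
[folklore] -/
def coeffTwo (α : (𝔼 2) [⋀^Fin 2]→L[ℝ] ℝ) : ℝ := α ⇑(EuclideanSpace.basisFun (Fin 2) ℝ)

/-- Unfolding `coeffTwo`. [folklore] -/
theorem coeffTwo_apply (α : (𝔼 2) [⋀^Fin 2]→L[ℝ] ℝ) :
    coeffTwo α = α ⇑(EuclideanSpace.basisFun (Fin 2) ℝ) := rfl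

/-- The top coefficient is a continuous function of the form. [folklore] -/
theorem continuous_coeffTwo : Continuous coeffTwo := by
  unfold coeffTwo
  fun_prop

/-- A `2`-form on `ℝ²` is `α(e₀, e₁)` times the standard determinant
(`AlternatingMap.eq_smul_basis_det`). [folklore] -/
theorem toAlternatingMap_eq_coeffTwo_smul_det (α : (𝔼 2) [⋀^Fin 2]→L[ℝ] ℝ) :
    α.toAlternatingMap = coeffTwo α • (EuclideanSpace.basisFun (Fin 2) ℝ).toBasis.det := by
  have key := AlternatingMap.eq_smul_basis_det (EuclideanSpace.basisFun (Fin 2) ℝ).toBasis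
    α.toAlternatingMap
  have h3 : (⇑(EuclideanSpace.basisFun (Fin 2) ℝ).toBasis : Fin 2 → 𝔼 2) =
      EuclideanSpace.basisFun (Fin 2) ℝ := by
    funext i
    simp
  rw [h3] at key
  exact key

/-- **`c(α ∘ A) = det A · c(α)`** for the top coefficient on `ℝ²`. [folklore] -/
theorem coeffTwo_compContinuousLinearMap (α : (𝔼 2) [⋀^Fin 2]→L[ℝ] ℝ) (A : (𝔼 2) →L[ℝ] 𝔼 2) :
    coeffTwo (α.compContinuousLinearMap A) = LinearMap.det (A : (𝔼 2) →ₗ[ℝ] 𝔼 2) * coeffTwo α := by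
  set b := EuclideanSpace.basisFun (Fin 2) ℝ with hb
  have h3 : (⇑b.toBasis : Fin 2 → 𝔼 2) = b := by
    funext i
    simp [hb]
  have h1 : coeffTwo (α.compContinuousLinearMap A) = α.toAlternatingMap ((A : 𝔼 2 → 𝔼 2) ∘ b) := by
    simp only [coeffTwo, ContinuousAlternatingMap.compContinuousLinearMap_apply]
    rfl
  rw [h1, toAlternatingMap_eq_coeffTwo_smul_det, AlternatingMap.smul_apply, smul_eq_mul]
  have h2 : b.toBasis.det ((A : (𝔼 2) →ₗ[ℝ] 𝔼 2) ∘ b.toBasis) =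
      LinearMap.det (A : (𝔼 2) →ₗ[ℝ] 𝔼 2) * b.toBasis.det b.toBasis :=
    Module.Basis.det_comp b.toBasis _ b.toBasis
  rw [Module.Basis.det_self, mul_one, h3] at h2
  have h4 : (A : 𝔼 2 → 𝔼 2) ∘ b = ((A : (𝔼 2) →ₗ[ℝ] 𝔼 2) : 𝔼 2 → 𝔼 2) ∘ b := rfl
  rw [h4, h2]
  ring

/-- **A nondegenerate `2`-form on `ℝ²` has non-zero top coefficient**: otherwise the form, a
multiple of the determinant, vanishes identically (McDuff–Salamon 2017, Cor. 2.1.4 with `n = 1`).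
[cite: McDuffSalamon2017, §2.1 Cor. 2.1.4] -/
theorem coeffTwo_ne_zero_of_nondegenerate (α : (𝔼 2) [⋀^Fin 2]→L[ℝ] ℝ)
    (hα : ∀ v : 𝔼 2, v ≠ 0 → ∃ w, α ![v, w] ≠ 0) : coeffTwo α ≠ 0 := by
  intro h0
  have hzero : α.toAlternatingMap = 0 := by
    rw [toAlternatingMap_eq_coeffTwo_smul_det, h0, zero_smul]
  have hv : ((EuclideanSpace.basisFun (Fin 2) ℝ).toBasis 0 : 𝔼 2) ≠ 0 :=
    (EuclideanSpace.basisFun (Fin 2) ℝ).toBasis.ne_zero 0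
  obtain ⟨w, hw⟩ := hα _ hv
  apply hw
  change α.toAlternatingMap ![(EuclideanSpace.basisFun (Fin 2) ℝ).toBasis 0, w] = 0
  rw [hzero]
  rfl

variable {S : Type u} [TopologicalSpace S] [ChartedSpace (𝔼 2) S] [IsManifold (𝓡 2) ∞ S]

/-- **The symplectic (area) orientation of a surface carrying a nondegenerate `2`-form**
(McDuff–Salamon 2017, §2.1: an area form orients a surface): `y ↦ sign t_y(e₀, e₁) · [e₀, e₁]`
(`smoothOrientationOfCoeff` with `c = coeffTwo`). [cite: McDuffSalamon2017, §2.1 Cor. 2.1.4] -/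
def surfaceSmoothOrientation (t : MForm (𝓡 2) S ℝ 2) (ht : IsSmoothForm t)
    (hnd : ∀ y (v : TangentSpace (𝓡 2) y), v ≠ 0 → ∃ w : TangentSpace (𝓡 2) y, t y ![v, w] ≠ 0) :
    SmoothOrientation (𝓡 2) S :=
  smoothOrientationOfCoeff coeffTwo continuous_coeffTwo coeffTwo_compContinuousLinearMap t ht
    fun y ↦ coeffTwo_ne_zero_of_nondegenerate _ (hnd y)

/-- The area orientation at a point: `sign t_y(e₀, e₁) · [e₀, e₁]`. [folklore] -/
theorem surfaceSmoothOrientation_apply (t : MForm (𝓡 2) S ℝ 2) (ht : IsSmoothForm t)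
    (hnd : ∀ y (v : TangentSpace (𝓡 2) y), v ≠ 0 → ∃ w : TangentSpace (𝓡 2) y, t y ![v, w] ≠ 0)
    (y : S) :
    surfaceSmoothOrientation t ht hnd y = signOrientationIn 2 (coeffTwo (t y)) := rfl

/-- The area orientation of a surface with a nondegenerate `2`-form, as a homological
`ℤ`-orientation (Milnor–Stasheff 1974, Appendix A, through the tree's bridge
`homologicalOrientationOfSmooth`). [cite: MilnorStasheff1974, Appendix A] -/
def surfaceOrientation [T2Space S] (t : MForm (𝓡 2) S ℝ 2) (ht : IsSmoothForm t)
    (hnd : ∀ y (v : TangentSpace (𝓡 2) y), v ≠ 0 → ∃ w : TangentSpace (𝓡 2) y, t y ![v, w] ≠ 0) :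
    HomologicalOrientation ℤ S 2 :=
  HomologicalOrientationOfSmooth.homologicalOrientationOfSmooth (surfaceSmoothOrientation t ht hnd)

variable {N : Type v} [TopologicalSpace N] [ChartedSpace (𝔼 4) N] [IsManifold (𝓡 4) ∞ N]

/-- `f ∘ (a, b) = (f a, f b)` for pairs of vectors. [folklore] -/
private theorem comp_vecTwo {X Y : Type*} (f : X → Y) (a b : X) :
    (fun i ↦ f (![a, b] i)) = ![f a, f b] := by
  funext i
  fin_cases i <;> rfl

omit [IsManifold (𝓡 2) ∞ S] [IsManifold (𝓡 4) ∞ N] in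
/-- The pull-back `b^* s` of a `2`-form along `b : S → N`, evaluated on a pair of tangent vectors:
`(b^* s)_y(v, w) = s_{b y}(db_y v, db_y w)` (`Literature.Geometry.Kaehler.MForm.pullback_apply`).
[folklore] -/
theorem pullback_apply_vecTwo (s : MForm (𝓡 4) N ℝ 2) (b : S → N) (y : S)
    (v w : TangentSpace (𝓡 2) y) :
    s.pullback (𝓡 2) b y ![v, w] =
      s (b y) ![mfderiv (𝓡 2) (𝓡 4) b y v, mfderiv (𝓡 2) (𝓡 4) b y w] := by
  rw [MForm.pullback_apply, comp_vecTwo]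

/-- **The symplectic orientation of a symplectic surface in a symplectic `4`-manifold** (the `μS`
of `canonicalClass_sq_and_adjunction_of_symplectic_four`; McDuff–Salamon 2017, §2.1 and
Ex. 4.4.5: a symplectic submanifold is oriented by the restriction of `ω`): for a smooth `2`-form
`s` on `N` and a smooth map `b : S → N` with `b^* s` nondegenerate on `S`, the area orientation
of `b^* s` (smooth by the tree's pull-back calculus `isSmoothForm_pullback`), as a homological
`ℤ`-orientation of `S`. [cite: McDuffSalamon2017, §2.1 Cor. 2.1.4; Ex. 4.4.5] -/
def symplecticSurfaceOrientation [T2Space S] (s : MForm (𝓡 4) N ℝ 2) (hs : IsSmoothForm s)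
    (b : S → N) (hb : ContMDiff (𝓡 2) (𝓡 4) ∞ b)
    (hnd : ∀ y (v : TangentSpace (𝓡 2) y), v ≠ 0 → ∃ w : TangentSpace (𝓡 2) y,
      s (b y) ![mfderiv (𝓡 2) (𝓡 4) b y v, mfderiv (𝓡 2) (𝓡 4) b y w] ≠ 0) :
    HomologicalOrientation ℤ S 2 :=
  surfaceOrientation (s.pullback (𝓡 2) b)
    (Literature.NumberTheory.Transcendental.isSmoothForm_pullback hb hs)
    fun y v hv ↦ by
      obtain ⟨w, hw⟩ := hnd y v hv
      exact ⟨w, by rwa [pullback_apply_vecTwo]⟩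

/-- A surface admitting a smooth map into a `4`-manifold along which a smooth `2`-form pulls back
to a nondegenerate form (e.g. a symplectic surface in a symplectic `4`-manifold) is
`ℤ`-orientable. [cite: McDuffSalamon2017, §2.1] -/
theorem isOrientableOver_int_surface_of_nondegenerate [T2Space S] (s : MForm (𝓡 4) N ℝ 2)
    (hs : IsSmoothForm s) (b : S → N) (hb : ContMDiff (𝓡 2) (𝓡 4) ∞ b)
    (hnd : ∀ y (v : TangentSpace (𝓡 2) y), v ≠ 0 → ∃ w : TangentSpace (𝓡 2) y,
      s (b y) ![mfderiv (𝓡 2) (𝓡 4) b y v, mfderiv (𝓡 2) (𝓡 4) b y w] ≠ 0) :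
    IsOrientableOver ℤ S 2 :=
  ⟨symplecticSurfaceOrientation s hs b hb hnd⟩

end Two

end Literature.Geometry.Symplectic

end
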